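import Mathlib
import Summits.Ventures.PercRepro2.ExplorationTreeCondExp
import Summits.Ventures.PercRepro2.EdgeSplitCondExp

/-!
# The law of total covariance over a stopping exploration (blind cell PercRepro2, typer-1 g19; a
language line)

`ExplorationTreeCondExp.lean` identified the conditional expectation given a stopping exploration
`t` (`leafSigma t`) with the pinned expectation at its leaf (`leafMean`).  This file splits a
covariance along the leaves of `t` and identifies the split with the general law of total
covariance of `CondCovariance.lean` (part IV-d) for the σ-algebra `leafSigma t`:

* `sum_leaves_prob`: the leaf weights sum to one;
* **`integral_condCovSigma_leafSigma`** (the WITHIN part):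
  `μ_p[Cov(f, g | leafSigma t)] = Σ_{ℓ ∈ leaves t root} P_p(ℓ) · cov[f, g; μ_{pin p ℓ}]`;
* **`covariance_leafMean`** / `covariance_leafMean_centered` (the BETWEEN part):
  `cov[leafMean f, leafMean g; μ_p] = Σ_ℓ P_p(ℓ) E_{pin ℓ} f · E_{pin ℓ} g − E_p f · E_p g
  = Σ_ℓ P_p(ℓ) (E_{pin ℓ} f − E_p f)(E_{pin ℓ} g − E_p g)`;
* **`covariance_eq_sum_leaves_pin_add_covariance_leafMean`** (the law of total covariance over
  the exploration, from `integral_condCovSigma_add_covariance_condExp`):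
  `cov[f, g; μ_p] = Σ_ℓ P_p(ℓ) · cov[f, g; μ_{pin p ℓ}] + cov[leafMean f, leafMean g; μ_p]`;
* `covariance_eq_sum_leaves`: the same fully explicit,
  `cov[f, g; μ_p] = Σ_ℓ P_p(ℓ) (cov[f, g; μ_{pin p ℓ}] + (E_{pin ℓ} f − E_p f)(E_{pin ℓ} g − E_p g))`.

* `covariance_eq_pin_of_one_node`: the edge split of `EdgeSplit.lean` (`covariance_eq_pin`) is
  the leaf split of the one-node tree `node e leaf leaf` (`pin_root_extend_true` / `_false`:
  pinning the root on the status of `e` is the weight update `p[e ↦ 1]` / `p[e ↦ 0]`).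

Identities only; nothing about the sign of any term.
-/

namespace Summit.Ventures.PercRepro2

open MeasureTheory ProbabilityTheory MeasureBridge

namespace ExplorationTree

section Cov

variable {E : Type*} [Fintype E] [DecidableEq E]

/-- The leaf weights of a valid tree sum to one. -/
lemma sum_leaves_prob (p : E → ℝ) (t : ETree E) (hv : Valid t ∅) :
    ((leaves t root).map fun ℓ => prob p ℓ.event).sum = 1 := by
  have h := expect_eq_sum_leaves_pin p t hv (fun _ => (1 : ℝ))
  rw [expect_const] at h
  rw [h]
  congr 1
  refine List.map_congr_left fun ℓ _ => ?_
  rw [expect_const, mul_one]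

/-- On the event of a leaf the pinned mean at the leaf reached is the pinned mean at that leaf. -/
lemma leafMean_eq_of_mem_event (p : E → ℝ) (t : ETree E) (hv : Valid t ∅) (f : Config E → ℝ)
    {ℓ : Partial E} (hℓ : ℓ ∈ leaves t root) {ω : Config E} (hω : ω ∈ ℓ.event) :
    leafMean p t f ω = expect (pin p ℓ) f := by
  simp only [leafMean]
  rw [leafOf_eq_of_mem_event t root hv ℓ hℓ ω hω]

/-- **The WITHIN part**: the mean conditional covariance given a stopping exploration is the
leaf-weighted sum of the pinned covariances. -/
theorem integral_condCovSigma_leafSigma (p : E → ℝ) (hp : IsProbVec p) (t : ETree E)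
    (hv : Valid t ∅) (f g : Config E → ℝ) :
    (∫ ω, CovForm.A3Means.condCovSigma (leafSigma t) f g (percMeasureOf p hp) ω
        ∂(percMeasureOf p hp)) =
      ((leaves t root).map fun ℓ =>
        prob p ℓ.event * cov[f, g; percMeasureOf (pin p ℓ) (isProbVec_pin hp ℓ)]).sum := by
  unfold CovForm.A3Means.condCovSigma
  rw [integral_condExp (leafSigma_le t)]
  have hcongr : (fun ω => (f ω - ((percMeasureOf p hp)[f | leafSigma t]) ω) *
        (g ω - ((percMeasureOf p hp)[g | leafSigma t]) ω)) =ᵐ[percMeasureOf p hp]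
      fun ω => (f ω - leafMean p t f ω) * (g ω - leafMean p t g ω) := by
    filter_upwards [condExp_leafSigma p hp t hv f, condExp_leafSigma p hp t hv g] with ω h1 h2
    rw [h1, h2]
  rw [integral_congr_ae hcongr, integral_percMeasureOf, expect_eq_sum_leaves_pin p t hv]
  congr 1
  refine List.map_congr_left fun ℓ hℓ => ?_
  congr 1
  have hc := expect_pin_congr p ℓ
    (f := fun ω => (f ω - leafMean p t f ω) * (g ω - leafMean p t g ω))
    (g := fun ω => (f ω - expect (pin p ℓ) f) * (g ω - expect (pin p ℓ) g))
    (fun ω hω => by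
      rw [leafMean_eq_of_mem_event p t hv f hℓ hω, leafMean_eq_of_mem_event p t hv g hℓ hω])
  rw [hc, EdgeSplit.expect_centered_mul, EdgeSplit.covariance_percMeasureOf]

/-- The pinned expectation on a leaf of the product of two leaf means is the product of the two
pinned means. -/
lemma expect_pin_leafMean_mul (p : E → ℝ) (t : ETree E) (hv : Valid t ∅) (f g : Config E → ℝ)
    {ℓ : Partial E} (hℓ : ℓ ∈ leaves t root) :
    expect (pin p ℓ) (fun ω => leafMean p t f ω * leafMean p t g ω) =
      expect (pin p ℓ) f * expect (pin p ℓ) g := by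
  have hc := expect_pin_congr p ℓ (f := fun ω => leafMean p t f ω * leafMean p t g ω)
    (g := fun _ => expect (pin p ℓ) f * expect (pin p ℓ) g)
    (fun ω hω => by
      rw [leafMean_eq_of_mem_event p t hv f hℓ hω, leafMean_eq_of_mem_event p t hv g hℓ hω])
  rw [hc, expect_const]

/-- **The BETWEEN part**: the covariance of the leaf means is
`Σ_ℓ P_p(ℓ) E_{pin ℓ} f · E_{pin ℓ} g − E_p f · E_p g`. -/
theorem covariance_leafMean (p : E → ℝ) (hp : IsProbVec p) (t : ETree E) (hv : Valid t ∅)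
    (f g : Config E → ℝ) :
    cov[leafMean p t f, leafMean p t g; percMeasureOf p hp] =
      ((leaves t root).map fun ℓ =>
        prob p ℓ.event * (expect (pin p ℓ) f * expect (pin p ℓ) g)).sum
        - expect p f * expect p g := by
  rw [EdgeSplit.covariance_percMeasureOf, expect_leafMean p hp t hv, expect_leafMean p hp t hv,
    expect_eq_sum_leaves_pin p t hv (fun ω => leafMean p t f ω * leafMean p t g ω)]
  congr 1
  congr 1
  refine List.map_congr_left fun ℓ hℓ => ?_
  rw [expect_pin_leafMean_mul p t hv f g hℓ]

/-- The centred expansion of a weighted sum (a list identity). -/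
lemma sum_map_mul_sub_mul_sub {ι : Type*} (l : List ι) (w a b : ι → ℝ) (A B : ℝ) :
    (l.map fun i => w i * ((a i - A) * (b i - B))).sum =
      (l.map fun i => w i * (a i * b i)).sum - A * (l.map fun i => w i * b i).sum
        - B * (l.map fun i => w i * a i).sum + A * B * (l.map w).sum := by
  induction l with
  | nil => simp
  | cons i l ih =>
    simp only [List.map_cons, List.sum_cons]
    rw [ih]
    ring

/-- **The BETWEEN part, centred**:
`cov[leafMean f, leafMean g; μ_p] = Σ_ℓ P_p(ℓ) (E_{pin ℓ} f − E_p f)(E_{pin ℓ} g − E_p g)`. -/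
theorem covariance_leafMean_centered (p : E → ℝ) (hp : IsProbVec p) (t : ETree E)
    (hv : Valid t ∅) (f g : Config E → ℝ) :
    cov[leafMean p t f, leafMean p t g; percMeasureOf p hp] =
      ((leaves t root).map fun ℓ => prob p ℓ.event *
        ((expect (pin p ℓ) f - expect p f) * (expect (pin p ℓ) g - expect p g))).sum := by
  rw [covariance_leafMean p hp t hv f g, sum_map_mul_sub_mul_sub, ← expect_eq_sum_leaves_pin p t hv f,
    ← expect_eq_sum_leaves_pin p t hv g, sum_leaves_prob p t hv]
  ring

/-- **The law of total covariance over a stopping exploration** (from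
`integral_condCovSigma_add_covariance_condExp` for `leafSigma t`):
`cov[f, g; μ_p] = Σ_ℓ P_p(ℓ) · cov[f, g; μ_{pin p ℓ}] + cov[leafMean f, leafMean g; μ_p]`. -/
theorem covariance_eq_sum_leaves_pin_add_covariance_leafMean (p : E → ℝ) (hp : IsProbVec p)
    (t : ETree E) (hv : Valid t ∅) (f g : Config E → ℝ) :
    cov[f, g; percMeasureOf p hp] =
      ((leaves t root).map fun ℓ =>
        prob p ℓ.event * cov[f, g; percMeasureOf (pin p ℓ) (isProbVec_pin hp ℓ)]).sum
        + cov[leafMean p t f, leafMean p t g; percMeasureOf p hp] := by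
  have htot := CovForm.A3Means.integral_condCovSigma_add_covariance_condExp
    (μ := percMeasureOf p hp) (leafSigma_le t) (X := f) (Y := g) MemLp.of_discrete MemLp.of_discrete
  have hbtw : cov[(percMeasureOf p hp)[f | leafSigma t], (percMeasureOf p hp)[g | leafSigma t];
      percMeasureOf p hp] = cov[leafMean p t f, leafMean p t g; percMeasureOf p hp] := by
    unfold covariance
    rw [integral_congr_ae (condExp_leafSigma p hp t hv f),
      integral_congr_ae (condExp_leafSigma p hp t hv g)]
    refine integral_congr_ae ?_
    filter_upwards [condExp_leafSigma p hp t hv f, condExp_leafSigma p hp t hv g] with ω h1 h2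
    rw [h1, h2]
  rw [← htot, integral_condCovSigma_leafSigma p hp t hv, hbtw]

/-- **The leaf split of a covariance, fully explicit**:
`cov[f, g; μ_p] = Σ_ℓ P_p(ℓ) (cov[f, g; μ_{pin p ℓ}] + (E_{pin ℓ} f − E_p f)(E_{pin ℓ} g − E_p g))`. -/
theorem covariance_eq_sum_leaves (p : E → ℝ) (hp : IsProbVec p) (t : ETree E) (hv : Valid t ∅)
    (f g : Config E → ℝ) :
    cov[f, g; percMeasureOf p hp] =
      ((leaves t root).map fun ℓ => prob p ℓ.event *
        (cov[f, g; percMeasureOf (pin p ℓ) (isProbVec_pin hp ℓ)] +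
          (expect (pin p ℓ) f - expect p f) * (expect (pin p ℓ) g - expect p g))).sum := by
  rw [covariance_eq_sum_leaves_pin_add_covariance_leafMean p hp t hv f g,
    covariance_leafMean_centered p hp t hv f g, ← List.sum_map_add]
  congr 1
  refine List.map_congr_left fun ℓ _ => ?_
  ring

/-! ## The one-node tree is the edge split -/

omit [Fintype E] in
/-- Pinning the root on `{e open}` is the weight update `p[e ↦ 1]`. -/
lemma pin_root_extend_true (p : E → ℝ) (e : E) :
    pin p (root.extend e true) = Function.update p e 1 := by
  funext e'
  by_cases h : e' = e
  · subst h
    simp [pin, Partial.extend, root]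
  · simp [pin, Partial.extend, root, h]

omit [Fintype E] in
/-- Pinning the root on `{e closed}` is the weight update `p[e ↦ 0]`. -/
lemma pin_root_extend_false (p : E → ℝ) (e : E) :
    pin p (root.extend e false) = Function.update p e 0 := by
  funext e'
  by_cases h : e' = e
  · subst h
    simp [pin, Partial.extend, root]
  · simp [pin, Partial.extend, root, h]

omit [DecidableEq E] in
/-- `percMeasureOf` only depends on the weight vector. -/
lemma percMeasureOf_congr {p q : E → ℝ} (hp : IsProbVec p) (hq : IsProbVec q) (h : p = q) :
    percMeasureOf p hp = percMeasureOf q hq := by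
  subst h
  rfl

/-- **The edge split is the leaf split of the one-node tree**: `EdgeSplit.covariance_eq_pin`
re-derived from `covariance_eq_sum_leaves` for the tree `node e leaf leaf` (reveal `e`, stop). -/
theorem covariance_eq_pin_of_one_node (p : E → ℝ) (hp : IsProbVec p) (e : E)
    (f g : Config E → ℝ) :
    cov[f, g; percMeasureOf p hp] =
      p e * cov[f, g; percMeasureOf (Function.update p e 1) (hp.update e zero_le_one le_rfl)]
      + (1 - p e) * cov[f, g; percMeasureOf (Function.update p e 0) (hp.update e le_rfl zero_le_one)]
      + p e * (1 - p e) * (expect (Function.update p e 1) f - expect (Function.update p e 0) f)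
          * (expect (Function.update p e 1) g - expect (Function.update p e 0) g) := by
  have hv : Valid (ETree.node e .leaf .leaf) (∅ : Finset E) :=
    ⟨Finset.notMem_empty e, trivial, trivial⟩
  have h1 : percMeasureOf (pin p (root.extend e true)) (isProbVec_pin hp (root.extend e true)) =
      percMeasureOf (Function.update p e 1) (hp.update e zero_le_one le_rfl) :=
    percMeasureOf_congr _ _ (pin_root_extend_true p e)
  have h0 : percMeasureOf (pin p (root.extend e false)) (isProbVec_pin hp (root.extend e false)) =
      percMeasureOf (Function.update p e 0) (hp.update e le_rfl zero_le_one) :=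
    percMeasureOf_congr _ _ (pin_root_extend_false p e)
  rw [covariance_eq_sum_leaves p hp (ETree.node e .leaf .leaf) hv f g]
  simp only [leaves, List.singleton_append, List.map_cons, List.map_nil, List.sum_cons,
    List.sum_nil, add_zero]
  rw [h1, h0, pin_root_extend_true, pin_root_extend_false,
    extend_event_false root (Finset.notMem_empty e), extend_event_true root (Finset.notMem_empty e),
    root_event, Set.univ_inter, Set.univ_inter, prob_closedEdge, prob_openEdge,
    expect_eq_pin p f e, expect_eq_pin p g e]
  ring

end Cov

end ExplorationTree

end Summit.Ventures.PercRepro2
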